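import Literature.MathematicalPhysics.QuantumLattice.HartreeFockSDWTorus
import Literature.MathematicalPhysics.QuantumLattice.HubbardTTPrimeHartreeFockCeiling
import Literature.MathematicalPhysics.QuantumLattice.HubbardNNNHoppingParticleHole
import HarnessLib

/-!
# Ventures/CertifiedManyBodySolver — Observables/NeelClassFloorOneBody.lean

HONEST FRAMING: first certified bounds; not a superconductivity verdict; every number certified or labelled float.
A competing-order EXCLUSION removes a named class of candidate ground states; it never says which order is present;
no phase sentence follows.

Cell `hubbard-tc` (MO-S3, D-0096), seat `hubbard-tc-mod-3` (G3: competing orders — stripe/CDW/AF — as EXCLUSION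
inputs from certified energy ORDERINGS), `prover-hubbard-tc-mod-3-g7-0`. The AF item of the seat's row: the KERNEL
device behind the G3 words «Néel (antiferromagnetic) mean-field class excluded» (`NeelClassExclusion*.lean`).
Family `hubbard`; namespace `Summit.Ventures.CertifiedManyBodySolver.Observables.NeelClassFloor`.

Part 1 of 3 (one-body algebra) of the SDW-reference kinetic floor (`NeelClassKineticFloor.lean`): on the even square
torus `(ℤ/Lℤ)²`, `L ≥ 3`, with `K` the nearest-neighbour hopping matrix, `K'` the diagonal (next-nearest-neighbour)
hopping matrix, `S = diag((-1)^{x₁+x₂})` and the tree's SDW objects of `HartreeFockSDWTorus.lean` (`h_s = K + sΔS`,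
`R = (K² + Δ²)^{-1/2}`, `P_s = ½(1 - h_s R)`):
* §1 `S K' = K' S` (diagonal neighbours share a sublattice), the modulus
  `E := (K² + Δ²)R = conjDiag(E_k)`, `E h_s R = h_s`, `E` and `K'` commute with `P_s`, and the SDW decomposition
  `h_s + K' = (E + K')(1 - P_s) - (E - K')P_s` (`sdwH_add_hopMatrix_diag_eq`);
* §2 the hole-doped band edge: for the diagonal hopping parameter `τ ≥ 0` with `2τ ≤ |Δ|`, `|Δ|τ ≤ 2(t² - τ²)`,
  `√(ε_k² + Δ²) ≥ |Δ| + ε'_k` momentum by momentum (`sdwE_sub_siteDiagBand_sub_abs_nonneg`), whence the matrix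
  inequalities `E + K' ⪰ 0` (`4|τ| ≤ |Δ|`) and `E - K' - |Δ| ⪰ 0`.
Everything is PROVED; no definition, no named fact, no `sorry`.

## References

* E. H. Lieb, M. Loss, Duke Math. J. 71 (1993) 337, §8, Theorem 8.2 (sum of negative eigenvalues bounds
  `dΓ`; bathtub). [LiebLoss1993]
* J. S. Langer, D. C. Mattis, Phys. Lett. 36A (1971) 139, eqs. (2)–(3) (the two-sublattice one-body
  Hamiltonian `K ± ΔS`, bands `±√(ε² + Δ²)`). [LangerMattis1971]
* V. Bach, E. H. Lieb, J. P. Solovej, J. Stat. Phys. 76 (1994) 3, §2 eq. (2c.36) (quasi-free states: Wick's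
  rule `⟨n↑n↓⟩ = ⟨n↑⟩⟨n↓⟩` for collinear Slater determinants). [BachLiebSolovej1994]
* H. Xu et al., Science 384 (2024) eadh7691, eq. (1) (the `t–t'` Hubbard model, `t' < 0`). [XuEtAl2024]
-/

noncomputable section

namespace Summit.Ventures.CertifiedManyBodySolver.Observables

namespace NeelClassFloor

open Literature.MathematicalPhysics.QuantumLattice

open Matrix Finset Literature.Probability.LatticeModels
  Literature.MathematicalPhysics.QuantumLattice.RayleighBound
  Literature.MathematicalPhysics.QuantumLattice.HubbardBandBottom
  Literature.MathematicalPhysics.QuantumLattice.LangerMattis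
  Literature.MathematicalPhysics.QuantumLattice.HartreeFock
  Literature.MathematicalPhysics.QuantumLattice.TTPrimeFree
  Literature.MathematicalPhysics.QuantumLattice.FreeKinetic
open scoped ComplexOrder ComplexConjugate

variable {L : ℕ}

/-! ### §1 One-body algebra on the even torus: `K'`, `E = √(K² + Δ²)`, commutation with `P_s` -/

section OneBody

variable [NeZero L]

/-- `conjDiag f` and `conjDiag g` commute (both are functions of the torus momentum). [folklore] -/
theorem conjDiag_comm (f g : FermionTorus 2 L → ℂ) :
    conjDiag 2 L f * conjDiag 2 L g = conjDiag 2 L g * conjDiag 2 L f := by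
  rw [conjDiag_mul, conjDiag_mul, mul_comm]

omit [NeZero L] in
/-- `tr K' = 0` (no self-loops in the diagonal graph). [folklore] -/
theorem trace_hopMatrix_diag (t' : ℝ) : (hopMatrix (fermionTorusDiagGraph L) t').trace = 0 := by
  rw [Matrix.trace]
  refine Finset.sum_eq_zero fun x _ => ?_
  simp [hopMatrix]

omit [NeZero L] in
/-- **Diagonal neighbours lie on the same sublattice**: `S K' = K' S` on the even torus.
[cite: EsslerEtAl2005, §2.2.4, bipartite sublattices after eq. (2.60)] -/
theorem stagMatrix_mul_hopMatrix_diag (hLe : Even L) (t' : ℝ) :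
    stagMatrix 2 L * hopMatrix (fermionTorusDiagGraph L) t' =
      hopMatrix (fermionTorusDiagGraph L) t' * stagMatrix 2 L := by
  ext x y
  rw [stagMatrix, diagonal_mul, mul_diagonal]
  simp only [hopMatrix, Matrix.of_apply]
  split_ifs with h
  · rw [torusStagger_eq_of_diagAdj hLe h, mul_comm]
  · simp

/-- `S (conjDiag f) S`-free form: a `conjDiag` matrix commutes with `R`. [folklore] -/
theorem conjDiag_mul_sdwR (f : FermionTorus 2 L → ℂ) (t Δ : ℝ) :
    conjDiag 2 L f * sdwR 2 L t Δ = sdwR 2 L t Δ * conjDiag 2 L f := by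
  rw [sdwR, conjDiag_comm]

/-- A `conjDiag` matrix commutes with the torus hopping matrix (`L ≥ 3`). [folklore] -/
theorem conjDiag_mul_hopMatrix (hL : 3 ≤ L) (f : FermionTorus 2 L → ℂ) (t : ℝ) :
    conjDiag 2 L f * hopMatrix (fermionTorusGraph 2 L) t = hopMatrix (fermionTorusGraph 2 L) t * conjDiag 2 L f := by
  rw [hopMatrix_eq_conjDiag hL, conjDiag_comm]

/-- `E = (K² + Δ²) R = conjDiag (E_k)`: the positive square root `√(K² + Δ²)` as a function of the
hopping matrix. [cite: LangerMattis1971, eq. (3)] -/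
theorem sdwM_mul_sdwR_eq_conjDiag (hL : 3 ≤ L) (t : ℝ) {Δ : ℝ} (hΔ : Δ ≠ 0) :
    sdwM 2 L t Δ * sdwR 2 L t Δ = conjDiag 2 L (fun k => ((sdwE t Δ k : ℝ) : ℂ)) := by
  rw [sdwM_eq_conjDiag hL, sdwR, conjDiag_mul]
  congr 1
  funext k
  have hE := (sdwE_pos t hΔ k).ne'
  simp only [Pi.mul_apply]
  push_cast
  field_simp

/-- `E` is Hermitian. [folklore] -/
theorem isHermitian_sdwE_matrix (hL : 3 ≤ L) (t : ℝ) {Δ : ℝ} (hΔ : Δ ≠ 0) :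
    (sdwM 2 L t Δ * sdwR 2 L t Δ).IsHermitian := by
  rw [sdwM_mul_sdwR_eq_conjDiag hL t hΔ, Matrix.IsHermitian, conjTranspose_conjDiag]
  congr 1
  funext k
  simp

/-- `tr E = Σ_k E_k`. [folklore] -/
theorem trace_sdwE_matrix (hL : 3 ≤ L) (t : ℝ) {Δ : ℝ} (hΔ : Δ ≠ 0) :
    (sdwM 2 L t Δ * sdwR 2 L t Δ).trace = ∑ k : FermionTorus 2 L, ((sdwE t Δ k : ℝ) : ℂ) := by
  rw [sdwM_mul_sdwR_eq_conjDiag hL t hΔ, trace_conjDiag]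

/-- `(K² + Δ²) R R = 1` (the resolvent commutes with `K² + Δ²`). [folklore] -/
theorem sdwM_mul_sdwR_mul_sdwR (hL : 3 ≤ L) (t : ℝ) {Δ : ℝ} (hΔ : Δ ≠ 0) :
    sdwM 2 L t Δ * sdwR 2 L t Δ * sdwR 2 L t Δ = 1 := by
  have h := sdwR_mul_sdwR_mul_sdwM (d := 2) hL t hΔ
  rw [sdwM_eq_conjDiag hL] at h ⊢
  rw [sdwR] at h ⊢
  rw [conjDiag_mul, conjDiag_mul] at h ⊢
  rw [← h]
  congr 1
  funext k
  simp only [Pi.mul_apply]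
  ring

/-- `E h_s R = h_s`: the SDW Hamiltonian factors through its modulus and its sign `h_s R`.
[cite: LangerMattis1971, eq. (3)] -/
theorem sdwE_matrix_mul_sdwH_mul_sdwR (hL : 3 ≤ L) (hLe : Even L) (t : ℝ) {Δ : ℝ} (hΔ : Δ ≠ 0)
    (s : ℝ) :
    sdwM 2 L t Δ * sdwR 2 L t Δ * (sdwH 2 L t Δ s * sdwR 2 L t Δ) = sdwH 2 L t Δ s := by
  have hHR := sdwH_mul_sdwR (d := 2) hL hLe t hΔ s
  have hRM : sdwR 2 L t Δ * sdwM 2 L t Δ = sdwM 2 L t Δ * sdwR 2 L t Δ := by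
    rw [sdwM_eq_conjDiag hL, sdwR, conjDiag_comm]
  -- `h_s` commutes with `M = K² + Δ²`
  have hHM : sdwH 2 L t Δ s * sdwM 2 L t Δ = sdwM 2 L t Δ * sdwH 2 L t Δ s := by
    rw [sdwH, Matrix.add_mul, Matrix.mul_add, Matrix.smul_mul, Matrix.mul_smul,
      stagMatrix_mul_sdwM hLe]
    congr 1
    rw [sdwM, Matrix.mul_add, Matrix.add_mul, Matrix.mul_smul, Matrix.smul_mul, Matrix.mul_one,
      Matrix.one_mul, Matrix.mul_assoc]
  calc sdwM 2 L t Δ * sdwR 2 L t Δ * (sdwH 2 L t Δ s * sdwR 2 L t Δ)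
      = sdwM 2 L t Δ * sdwR 2 L t Δ * (sdwR 2 L t Δ * sdwH 2 L t Δ s) := by rw [hHR]
    _ = (sdwM 2 L t Δ * sdwR 2 L t Δ * sdwR 2 L t Δ) * sdwH 2 L t Δ s := by
        simp only [Matrix.mul_assoc]
    _ = sdwH 2 L t Δ s := by rw [sdwM_mul_sdwR_mul_sdwR hL t hΔ, Matrix.one_mul]

/-- `E` commutes with the staggering matrix (`S (K²+Δ²) S = K²+Δ²`, `S R S = R`). [folklore] -/
theorem stagMatrix_mul_sdwE_matrix (hL : 3 ≤ L) (hLe : Even L) (t : ℝ) {Δ : ℝ} (hΔ : Δ ≠ 0) :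
    stagMatrix 2 L * (sdwM 2 L t Δ * sdwR 2 L t Δ) = sdwM 2 L t Δ * sdwR 2 L t Δ * stagMatrix 2 L := by
  rw [← Matrix.mul_assoc, stagMatrix_mul_sdwM hLe, Matrix.mul_assoc, ← sdwR_mul_stagMatrix hL hLe t hΔ,
    Matrix.mul_assoc]

/-- A matrix commuting with `K`, `S` and `R` commutes with the band projection `P_s`. [folklore] -/
theorem mul_sdwProj_comm {F : Matrix (FermionTorus 2 L) (FermionTorus 2 L) ℂ} (t Δ s : ℝ)
    (hK : F * hopMatrix (fermionTorusGraph 2 L) t = hopMatrix (fermionTorusGraph 2 L) t * F)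
    (hS : F * stagMatrix 2 L = stagMatrix 2 L * F) (hR : F * sdwR 2 L t Δ = sdwR 2 L t Δ * F) :
    F * sdwProj 2 L t Δ s = sdwProj 2 L t Δ s * F := by
  have hH : F * sdwH 2 L t Δ s = sdwH 2 L t Δ s * F := by
    rw [sdwH, Matrix.mul_add, Matrix.add_mul, Matrix.mul_smul, Matrix.smul_mul, hK, hS]
  rw [sdwProj, Matrix.mul_smul, Matrix.smul_mul, Matrix.mul_sub, Matrix.sub_mul, Matrix.mul_one,
    Matrix.one_mul, ← Matrix.mul_assoc, hH, Matrix.mul_assoc, hR, ← Matrix.mul_assoc]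

/-- `E P_s = P_s E`. [folklore] -/
theorem sdwE_matrix_mul_sdwProj (hL : 3 ≤ L) (hLe : Even L) (t : ℝ) {Δ : ℝ} (hΔ : Δ ≠ 0) (s : ℝ) :
    sdwM 2 L t Δ * sdwR 2 L t Δ * sdwProj 2 L t Δ s = sdwProj 2 L t Δ s * (sdwM 2 L t Δ * sdwR 2 L t Δ) := by
  refine mul_sdwProj_comm t Δ s ?_ ?_ ?_
  · rw [sdwM_mul_sdwR_eq_conjDiag hL t hΔ, conjDiag_mul_hopMatrix hL]
  · rw [stagMatrix_mul_sdwE_matrix hL hLe t hΔ]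
  · rw [sdwM_mul_sdwR_eq_conjDiag hL t hΔ, conjDiag_mul_sdwR]

/-- `K' P_s = P_s K'`. [folklore] -/
theorem hopMatrix_diag_mul_sdwProj (hL : 3 ≤ L) (hLe : Even L) (t' t Δ s : ℝ) :
    hopMatrix (fermionTorusDiagGraph L) t' * sdwProj 2 L t Δ s =
      sdwProj 2 L t Δ s * hopMatrix (fermionTorusDiagGraph L) t' := by
  refine mul_sdwProj_comm t Δ s ?_ ?_ ?_
  · rw [hopMatrix_diag_eq_conjDiag hL, conjDiag_mul_hopMatrix hL]
  · rw [stagMatrix_mul_hopMatrix_diag hLe]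
  · rw [hopMatrix_diag_eq_conjDiag hL, conjDiag_mul_sdwR]

/-- **The SDW decomposition of the `t–t'` one-body matrix**:
`h_s + K' = (E + K')(1 - P_s) - (E - K')P_s`. [cite: LangerMattis1971, eqs. (2)–(3)] -/
theorem sdwH_add_hopMatrix_diag_eq (hL : 3 ≤ L) (hLe : Even L) (t t' : ℝ) {Δ : ℝ} (hΔ : Δ ≠ 0) (s : ℝ) :
    sdwH 2 L t Δ s + hopMatrix (fermionTorusDiagGraph L) t' =
      (sdwM 2 L t Δ * sdwR 2 L t Δ + hopMatrix (fermionTorusDiagGraph L) t') * (1 - sdwProj 2 L t Δ s) -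
        (sdwM 2 L t Δ * sdwR 2 L t Δ - hopMatrix (fermionTorusDiagGraph L) t') * sdwProj 2 L t Δ s := by
  have hE := sdwE_matrix_mul_sdwH_mul_sdwR hL hLe t hΔ s
  set E := sdwM 2 L t Δ * sdwR 2 L t Δ
  set K' := hopMatrix (fermionTorusDiagGraph L) t'
  set h := sdwH 2 L t Δ s
  set R := sdwR 2 L t Δ
  have hP : sdwProj 2 L t Δ s = (1 / 2 : ℂ) • (1 - h * R) := rfl
  rw [hP, Matrix.mul_sub, Matrix.mul_one, Matrix.mul_smul, Matrix.mul_smul, Matrix.mul_sub,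
    Matrix.mul_sub, Matrix.mul_one, Matrix.mul_one, Matrix.add_mul, Matrix.sub_mul, hE]
  ext i j
  simp only [Matrix.sub_apply, Matrix.add_apply, Matrix.smul_apply, smul_eq_mul]
  ring

end OneBody

/-! ### §2 The band edge for `t' ≤ 0`: `√(ε_k² + Δ²) ≥ |Δ| + ε'_k` momentum by momentum -/

/-- The elementary inequality behind the hole-doped (`t' ≤ 0`) band edge: for `a, b ∈ [-1, 1]`,
`τ ≥ 0`, `2τ ≤ D`, `Dτ ≤ 2(t² - τ²)`: `(D + 4τab)² ≤ 4t²(a+b)² + D²` whenever `0 ≤ D + 4τab`.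
[cite: LangerMattis1971, eq. (3)] -/
theorem sq_add_diag_le {a b t τ D : ℝ} (ha : -1 ≤ a) (ha' : a ≤ 1) (hb : -1 ≤ b) (hb' : b ≤ 1)
    (hτ : 0 ≤ τ) (h2 : 2 * τ ≤ D) (hD : D * τ ≤ 2 * (t ^ 2 - τ ^ 2)) :
    (D + 4 * τ * (a * b)) ^ 2 ≤ 4 * t ^ 2 * (a + b) ^ 2 + D ^ 2 := by
  -- it suffices: `8 D τ (ab) + 16 τ² (ab)² ≤ 4 t² (a+b)²`
  have hab1 : a * b ≤ 1 := by nlinarith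
  have hab1' : -1 ≤ a * b := by nlinarith
  rcases le_or_gt (a * b) 0 with hab | hab
  · -- `ab ≤ 0`: the left side is `≤ 0 ≤` the right side
    have h1 : 8 * D * τ + 16 * τ ^ 2 * (a * b) ≥ 0 := by nlinarith
    nlinarith [sq_nonneg (a + b), sq_nonneg t, mul_nonneg (mul_nonneg (by norm_num : (0:ℝ) ≤ 4) (sq_nonneg t)) (sq_nonneg (a + b))]
  · -- `ab > 0`: `ab ≤ (a+b)²/4` and `(ab)² ≤ ab`
    have hamgm : 4 * (a * b) ≤ (a + b) ^ 2 := by nlinarith [sq_nonneg (a - b)]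
    have hsq : (a * b) ^ 2 ≤ a * b := by nlinarith
    have hDτ : 0 ≤ D * τ := by nlinarith
    nlinarith [mul_le_mul_of_nonneg_left hamgm hDτ, mul_le_mul_of_nonneg_left hamgm (sq_nonneg τ),
      mul_le_mul_of_nonneg_left hsq (sq_nonneg τ), sq_nonneg (a + b)]

section BandEdge

variable [NeZero L]

/-- **Band edge, hole-doped sign.** For `τ ≥ 0`, `Δ ≠ 0`, `2τ ≤ |Δ|`, `|Δ|τ ≤ 2(t² - τ²)` and every torus
momentum `k`: `|Δ| + ε'_k(τ) ≤ E_k`, `ε'_k(τ) = 4τ cos p₁ cos p₂`, `E_k = √((2t(cos p₁ + cos p₂))² + Δ²)` — the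
top of the lower SDW band of `K + K' - ΔS` is `-|Δ|`. [cite: LangerMattis1971, eq. (3)] -/
theorem sdwE_sub_siteDiagBand_sub_abs_nonneg {t τ Δ : ℝ} (hτ : 0 ≤ τ) (h2 : 2 * τ ≤ |Δ|)
    (hD : |Δ| * τ ≤ 2 * (t ^ 2 - τ ^ 2)) (k : FermionTorus 2 L) :
    0 ≤ sdwE t Δ k - siteDiagBand τ k - |Δ| := by
  set a := Real.cos (latticeMomentum L k.toTorusSite 0)
  set b := Real.cos (latticeMomentum L k.toTorusSite 1)
  have ha : -1 ≤ a := Real.neg_one_le_cos _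
  have ha' : a ≤ 1 := Real.cos_le_one _
  have hb : -1 ≤ b := Real.neg_one_le_cos _
  have hb' : b ≤ 1 := Real.cos_le_one _
  have hband : siteBand t k = t * (2 * (a + b)) := by
    simp only [siteBand, Fin.sum_univ_two, a, b]
  have hdiag : siteDiagBand τ k = 4 * τ * (a * b) := by
    simp only [siteDiagBand, a, b]; ring
  rw [hdiag, sdwE, hband]
  rcases le_or_gt 0 (|Δ| + 4 * τ * (a * b)) with hpos | hneg
  · have hsq : (|Δ| + 4 * τ * (a * b)) ^ 2 ≤ (t * (2 * (a + b))) ^ 2 + Δ ^ 2 := by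
      have h := sq_add_diag_le (t := t) ha ha' hb hb' hτ h2 hD
      have e1 : (t * (2 * (a + b))) ^ 2 = 4 * t ^ 2 * (a + b) ^ 2 := by ring
      rw [e1, ← sq_abs Δ]
      exact h
    have h3 : |Δ| + 4 * τ * (a * b) ≤ Real.sqrt ((t * (2 * (a + b))) ^ 2 + Δ ^ 2) :=
      Real.le_sqrt_of_sq_le hsq
    linarith
  · have h3 : 0 ≤ Real.sqrt ((t * (2 * (a + b))) ^ 2 + Δ ^ 2) := Real.sqrt_nonneg _
    linarith

omit [NeZero L] in
/-- `E_k ≥ |Δ|`. [cite: LangerMattis1971, eq. (3)] -/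
theorem abs_le_sdwE (t Δ : ℝ) (k : FermionTorus 2 L) : |Δ| ≤ sdwE t Δ k := by
  rw [sdwE]
  refine Real.le_sqrt_of_sq_le ?_
  rw [sq_abs]
  nlinarith [sq_nonneg (siteBand t k)]

/-- `|ε'_k(τ)| ≤ 4|τ|`. [cite: XuEtAl2024, eq. (1)] -/
theorem abs_siteDiagBand_le (τ : ℝ) (k : FermionTorus 2 L) : |siteDiagBand τ k| ≤ 4 * |τ| := by
  rw [siteDiagBand, abs_mul]
  have h1 : |Real.cos (latticeMomentum L k.toTorusSite 0)| ≤ 1 := Real.abs_cos_le_one _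
  have h2 : |Real.cos (latticeMomentum L k.toTorusSite 1)| ≤ 1 := Real.abs_cos_le_one _
  have h : |4 * Real.cos (latticeMomentum L k.toTorusSite 0) * Real.cos (latticeMomentum L k.toTorusSite 1)| ≤ 4 := by
    rw [abs_mul, abs_mul]
    have h4 : |(4 : ℝ)| = 4 := abs_of_pos (by norm_num)
    rw [h4]
    nlinarith [abs_nonneg (Real.cos (latticeMomentum L k.toTorusSite 0)),
      abs_nonneg (Real.cos (latticeMomentum L k.toTorusSite 1))]
  calc |τ| * |4 * Real.cos (latticeMomentum L k.toTorusSite 0) * Real.cos (latticeMomentum L k.toTorusSite 1)|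
      ≤ |τ| * 4 := mul_le_mul_of_nonneg_left h (abs_nonneg τ)
    _ = 4 * |τ| := by ring

/-- **`E + K' ⪰ 0`** when `4|τ| ≤ |Δ|`. [cite: LangerMattis1971, eq. (3)] -/
theorem posSemidef_sdwE_add_diag (hL : 3 ≤ L) (t τ : ℝ) {Δ : ℝ} (hΔ : Δ ≠ 0) (h4 : 4 * |τ| ≤ |Δ|) :
    (sdwM 2 L t Δ * sdwR 2 L t Δ + hopMatrix (fermionTorusDiagGraph L) τ).PosSemidef := by
  rw [sdwM_mul_sdwR_eq_conjDiag hL t hΔ, hopMatrix_diag_eq_conjDiag hL, ← conjDiag_add]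
  refine posSemidef_conjDiag fun k => ?_
  simp only [Pi.add_apply]
  have h1 := abs_le_sdwE t Δ k
  have h2 := abs_siteDiagBand_le τ k
  have h3 : -(4 * |τ|) ≤ siteDiagBand τ k := by
    have := neg_abs_le (siteDiagBand τ k); linarith
  have h : (0 : ℝ) ≤ sdwE t Δ k + siteDiagBand τ k := by linarith
  exact_mod_cast Complex.zero_le_real.mpr h

/-- **`E - K' - |Δ| ⪰ 0`** for the hole-doped sign (`τ ≥ 0`, `2τ ≤ |Δ|`, `|Δ|τ ≤ 2(t² - τ²)`).
[cite: LangerMattis1971, eq. (3)] -/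
theorem posSemidef_sdwE_sub_diag_sub (hL : 3 ≤ L) (t : ℝ) {τ Δ : ℝ} (hΔ : Δ ≠ 0) (hτ : 0 ≤ τ)
    (h2 : 2 * τ ≤ |Δ|) (hD : |Δ| * τ ≤ 2 * (t ^ 2 - τ ^ 2)) :
    (sdwM 2 L t Δ * sdwR 2 L t Δ - hopMatrix (fermionTorusDiagGraph L) τ -
      ((|Δ| : ℝ) : ℂ) • (1 : Matrix (FermionTorus 2 L) (FermionTorus 2 L) ℂ)).PosSemidef := by
  rw [sdwM_mul_sdwR_eq_conjDiag hL t hΔ, hopMatrix_diag_eq_conjDiag hL, ← conjDiag_const]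
  have hsub : ∀ f g : FermionTorus 2 L → ℂ, conjDiag 2 L f - conjDiag 2 L g = conjDiag 2 L (f - g) := by
    intro f g
    rw [sub_eq_iff_eq_add, ← conjDiag_add, sub_add_cancel]
  rw [hsub, hsub]
  refine posSemidef_conjDiag fun k => ?_
  simp only [Pi.sub_apply]
  have h := sdwE_sub_siteDiagBand_sub_abs_nonneg (t := t) hτ h2 hD k
  exact_mod_cast Complex.zero_le_real.mpr h

end BandEdge

end NeelClassFloor

end Summit.Ventures.CertifiedManyBodySolver.Observables

end
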